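import Summits.HodgeConjecture.HodgeConjecture.Theorems.K2E3LocalUnitaryWittParabolicDefs
import Summits.HodgeConjecture.HodgeConjecture.Theorems.K2E3ParabolicCoarsening
import Literature.NumberTheory.Automorphic.UnitaryGroupCMLocalIwasawa
import HarnessLib

/-!
# K2 ∕ E3 «EllipticInputs», 13a road A, J4 (iii) for the quasi-split form: in a STANDARD indexing the Witt form `W(r, (1))` IS `Φ_{2r+1}`
# (`W(r, ∅)` is `Φ_{2r}`), the Witt labellings are MONOTONE, `B ≤ P_S`, and `U(Φ_N)(L⁺_v) = P_S · K_v` for every `S` (the DRIVER's `hGC`)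

Cell `hodgecm-mathlib` (Track B «K2-LIT»), item h413 = `stmt-HodgeConjecture-24833`; author K2E3-p10 (g2); count-neutral helper for the 13a line
(road A; DRIVER ★ `K2E3LocalIrrepAdmissibleOfConeInputs`, binder `hGC : ∀ i g, ∃ p : ↥(t i).P, ∃ c ∈ C i, g = p * c` with `C i` compact).
PROOF lane: theorems only (no `def`, no `instance`, no `sorry`), over K2-defs1's ★ `K2E3LocalUnitaryWittParabolicDefs` (`wittFormOn`,
`wittBlockOn`, `wittParabolic`), ★ `K2E3ParabolicCoarsening` (K2E3-p10) and the tree's ★ CM Iwasawa `U(Φ_N)(L⁺_v) = B · K_v`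
(`exists_borel_mul_mem_cmLocalIntegralLevel`, every `N`, every finite `v`).

A STANDARD indexing is any `e : WittIndex r m ≃ Fin N` placing `e₁…e_r` at positions `0…r−1`, the middle block at `r…r+m−1` and the `f`-slots at
`r+m…N−1` (hypothesis `hstd`; e.g. `(Equiv.sumCongr (Equiv.refl _) finSumFinEquiv).trans finSumFinEquiv`).  Then:

* §1 **`wittFormOn_eq_antidiag_of_std`** (`m = 1`, `Han 0 0 = 1`): `wittFormOn e Han = Φ_N` (the literal `of (fun i j => if i+j+1 = N then 1 else 0)`),
  and **`wittFormOn_eq_antidiag_of_std_zero`** (`m = 0`): the same.  So for ODD `N` (★ p855658: every `U_N(H)(L⁺_v) ≃ₜ* U(Φ_N)(L⁺_v)`) and for the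
  quasi-split EVEN case the Witt parabolics are parabolics of `U(Φ_N)` on the nose.
* §2 **`monotone_wittBlockOn_of_std`**: the labelling `wittBlockOn e S` is monotone in the position order (any `m`); hence
  **`borelU_le_wittParabolic_of_std`**: the Borel `B` (★ `borelU`, upper triangular) lies in every `P_S` (★ `standardParabolicGL_le_of_coarsening`).
* §3 **`exists_wittParabolic_mul_mem_cmLocalIntegralLevel`**: `U(Φ_N)(L⁺_v) = P_S · K_v` for every `S` and every standard `e` — the `hGC` binder with
  `C := K_v = cmLocalIntegralLevel` (compact open, ★ `isCompact_isOpen_cmLocalIntegralLevel`), at EVERY finite place `v` of `L⁺`.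

References: A. Borel, *Linear Algebraic Groups* (1991), §23; F. Bruhat, J. Tits (1972), (4.4.3); J. Rogawski (1990), §4.5 p. 45.
-/

set_option autoImplicit false
set_option linter.dupNamespace false

noncomputable section

namespace Summit.HodgeConjecture.HodgeConjecture.Cruxes.H413.K2E3WittStandardIndexing

open NumberField IsDedekindDomain
open Literature.NumberTheory.Automorphic Literature.NumberTheory.Automorphic.UnitaryGroup
open K2E3LocalUnitaryWitt K2E3ParabolicCoarsening
open scoped Matrix MatrixGroups

/-! ## §1 `W(r, (1)) = Φ_{2r+1}` and `W(r, ∅) = Φ_{2r}` in a standard indexing -/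

section Form

variable {R : Type*} [Zero R] [One R] {r N : ℕ}

/-- **`wittFormOn e Han = Φ_N` for a standard indexing `e` of `WittIndex r 1` and `Han = (1)`**: the antidiagonal pairing `e_i ↔` slot `rev i`
lands on the antidiagonal `i + j + 1 = N` of `Fin N`, the middle entry at `(r, r)`. [cite: Borel1991, §23] -/
theorem wittFormOn_eq_antidiag_of_std (e : WittIndex r 1 ≃ Fin N)
    (hstd : ∀ x, (e x).val = Sum.elim (fun i : Fin r => i.val) (Sum.elim (fun u : Fin 1 => r + u.val) (fun j : Fin r => r + 1 + j.val)) x)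
    (Han : Matrix (Fin 1) (Fin 1) R) (hHan : Han 0 0 = 1) :
    wittFormOn e Han = Matrix.of fun p q : Fin N => if p.val + q.val + 1 = N then (1 : R) else 0 := by
  have hN : N = r + (1 + r) := by simpa using (Fintype.card_congr e).symm
  ext p q
  obtain ⟨x, rfl⟩ := e.surjective p
  obtain ⟨y, rfl⟩ := e.surjective q
  rw [wittFormOn_apply, e.symm_apply_apply, e.symm_apply_apply, Matrix.of_apply, hstd x, hstd y]
  rcases x with i | u | j <;> rcases y with i' | u' | j'
  · rw [wittForm_inl_inl]; simp only [Sum.elim_inl]; rw [if_neg (by omega)]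
  · rw [wittForm_inl_inr_inl]; simp only [Sum.elim_inl, Sum.elim_inr]; rw [if_neg (by omega)]
  · rw [wittForm_inl_inr_inr]; simp only [Sum.elim_inl, Sum.elim_inr]
    by_cases h : i = Fin.rev j'
    · rw [if_pos h, if_pos]
      have := congrArg Fin.val h; rw [Fin.val_rev] at this; omega
    · rw [if_neg h, if_neg]
      intro h'; apply h; ext; rw [Fin.val_rev]; omega
  · rw [wittForm_inr_inl_inl]; simp only [Sum.elim_inl, Sum.elim_inr]; rw [if_neg (by omega)]
  · rw [wittForm_inr_inl_inr_inl, Fin.fin_one_eq_zero u, Fin.fin_one_eq_zero u', hHan]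
    simp only [Sum.elim_inr, Sum.elim_inl, Fin.val_zero]; rw [if_pos (by omega)]
  · rw [wittForm_inr_inl_inr_inr]; simp only [Sum.elim_inr, Sum.elim_inl]; rw [if_neg (by omega)]
  · rw [wittForm_inr_inr_inl]; simp only [Sum.elim_inl, Sum.elim_inr]
    by_cases h : j = Fin.rev i'
    · rw [if_pos h, if_pos]
      have := congrArg Fin.val h; rw [Fin.val_rev] at this; omega
    · rw [if_neg h, if_neg]
      intro h'; apply h; ext; rw [Fin.val_rev]; omega
  · rw [wittForm_inr_inr_inr_inl]; simp only [Sum.elim_inr, Sum.elim_inl]; rw [if_neg (by omega)]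
  · rw [wittForm_inr_inr_inr_inr]; simp only [Sum.elim_inr]; rw [if_neg (by omega)]

/-- **`wittFormOn e Han = Φ_N` for a standard indexing of `WittIndex r 0`** (no anisotropic kernel, `N = 2r`). [cite: Borel1991, §23] -/
theorem wittFormOn_eq_antidiag_of_std_zero (e : WittIndex r 0 ≃ Fin N)
    (hstd : ∀ x, (e x).val = Sum.elim (fun i : Fin r => i.val) (Sum.elim (fun u : Fin 0 => r + u.val) (fun j : Fin r => r + j.val)) x)
    (Han : Matrix (Fin 0) (Fin 0) R) :
    wittFormOn e Han = Matrix.of fun p q : Fin N => if p.val + q.val + 1 = N then (1 : R) else 0 := by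
  have hN : N = r + (0 + r) := by simpa using (Fintype.card_congr e).symm
  ext p q
  obtain ⟨x, rfl⟩ := e.surjective p
  obtain ⟨y, rfl⟩ := e.surjective q
  rw [wittFormOn_apply, e.symm_apply_apply, e.symm_apply_apply, Matrix.of_apply, hstd x, hstd y]
  rcases x with i | u | j
  · rcases y with i' | u' | j'
    · rw [wittForm_inl_inl]; simp only [Sum.elim_inl]; rw [if_neg (by omega)]
    · exact u'.elim0
    · rw [wittForm_inl_inr_inr]; simp only [Sum.elim_inl, Sum.elim_inr]
      by_cases h : i = Fin.rev j'
      · rw [if_pos h, if_pos]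
        have := congrArg Fin.val h; rw [Fin.val_rev] at this; omega
      · rw [if_neg h, if_neg]
        intro h'; apply h; ext; rw [Fin.val_rev]; omega
  · exact u.elim0
  · rcases y with i' | u' | j'
    · rw [wittForm_inr_inr_inl]; simp only [Sum.elim_inl, Sum.elim_inr]
      by_cases h : j = Fin.rev i'
      · rw [if_pos h, if_pos]
        have := congrArg Fin.val h; rw [Fin.val_rev] at this; omega
      · rw [if_neg h, if_neg]
        intro h'; apply h; ext; rw [Fin.val_rev]; omega
    · exact u'.elim0
    · rw [wittForm_inr_inr_inr_inr]; simp only [Sum.elim_inr]; rw [if_neg (by omega)]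

end Form

/-! ## §2 The Witt labellings are monotone in a standard indexing; `B ≤ P_S` -/

section Labels

variable {r m N : ℕ}

/-- **`wittBlockOn e S` is monotone in the position order** for a standard indexing `e` (labels: `#{breaks < i}` on `e_i`, `L` on the middle block,
`L + #{breaks ≤ j via rev}` on the `f`-slots — non-decreasing from left to right). [cite: Borel1991, §23] -/
theorem monotone_wittBlockOn_of_std (e : WittIndex r m ≃ Fin N)
    (hstd : ∀ x, (e x).val = Sum.elim (fun i : Fin r => i.val) (Sum.elim (fun u : Fin m => r + u.val) (fun j : Fin r => r + m + j.val)) x)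
    (S : Finset (Fin r)) : Monotone (wittBlockOn e S) := by
  intro p q hpq
  obtain ⟨x, rfl⟩ := e.surjective p
  obtain ⟨y, rfl⟩ := e.surjective q
  rw [Fin.le_iff_val_le_val, hstd x, hstd y] at hpq
  rw [Fin.le_iff_val_le_val, wittBlockOn_apply, wittBlockOn_apply, e.symm_apply_apply, e.symm_apply_apply, wittBlock_val, wittBlock_val]
  have hL : ∀ i : Fin r, ((Finset.univ \ S).filter fun α => α.val < i.val).card ≤ (Finset.univ \ S).card := fun i => Finset.card_filter_le _ _
  rcases x with i | u | j <;> rcases y with i' | u' | j' <;>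
    simp only [Sum.elim_inl, Sum.elim_inr] at hpq
  · -- `e_i ≤ e_{i'}`
    change ((Finset.univ \ S).filter fun α => α.val < i.val).card ≤ ((Finset.univ \ S).filter fun α => α.val < i'.val).card
    refine Finset.card_le_card fun α hα => ?_
    simp only [Finset.mem_filter] at hα ⊢
    exact ⟨hα.1, lt_of_lt_of_le hα.2 hpq⟩
  · exact hL i
  · change ((Finset.univ \ S).filter fun α => α.val < i.val).card ≤ (Finset.univ \ S).card + _
    exact (hL i).trans (Nat.le_add_right _ _)
  · exfalso; omega
  · exact le_rfl
  · change (Finset.univ \ S).card ≤ (Finset.univ \ S).card + _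
    exact Nat.le_add_right _ _
  · exfalso; omega
  · exfalso; omega
  · change (Finset.univ \ S).card + ((Finset.univ \ S).filter fun α => (Fin.rev α).val ≤ j.val).card ≤
      (Finset.univ \ S).card + ((Finset.univ \ S).filter fun α => (Fin.rev α).val ≤ j'.val).card
    refine Nat.add_le_add_left (Finset.card_le_card fun α hα => ?_) _
    simp only [Finset.mem_filter] at hα ⊢
    exact ⟨hα.1, le_trans hα.2 (by omega)⟩

variable {R : Type*} [CommRing R] (σ : R →+* R) (J : Matrix (Fin N) (Fin N) R)

/-- **`B ≤ P_S`**: the upper triangular Borel of `U(σ, J)` (★ `borelU`) lies in every Witt parabolic `wittParabolic σ J e S` of a standard indexing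
(★ `standardParabolicGL_le_of_coarsening` with the monotone labelling). [cite: Borel1991, §23] -/
theorem borelU_le_wittParabolic_of_std (e : WittIndex r m ≃ Fin N)
    (hstd : ∀ x, (e x).val = Sum.elim (fun i : Fin r => i.val) (Sum.elim (fun u : Fin m => r + u.val) (fun j : Fin r => r + m + j.val)) x)
    (S : Finset (Fin r)) : borelU σ J ≤ wittParabolic σ J e S := by
  intro g hg
  rw [mem_borelU_iff] at hg
  rw [mem_wittParabolic_iff]
  exact standardParabolicGL_le_of_coarsening (R := R) (id : Fin N → Fin N) (wittBlockOn e S)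
    (fun k l hkl => monotone_wittBlockOn_of_std e hstd S hkl) hg

end Labels

/-! ## §3 `U(Φ_N)(L⁺_v) = P_S · K_v` (the DRIVER's `hGC`) -/

section CM

variable (L : Type) [Field L] [NumberField L] [IsCMField L] (N : ℕ) (v : HeightOneSpectrum (𝓞 ↥(maximalRealSubfield L))) {r m : ℕ}

/-- **`U(Φ_N)(L⁺_v) = P_S · K_v` for every `S`** and every standard indexing `e : WittIndex r m ≃ Fin N`: every `g` of the CM local carrier
`↥U(c ⊗ 1, cmLocalForm L N v) = (cmDatum L N Φ_N).Local v` is `p κ` with `p ∈ wittParabolic … e S` and `κ ∈ K_v = cmLocalIntegralLevel L N Φ_N v`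
(★ Iwasawa `U = B · K_v` + `B ≤ P_S`); `K_v` is compact open (★ `isCompact_isOpen_cmLocalIntegralLevel`) — the `hGC` binder.
[cite: BruhatTits1972, (4.4.3)] [cite: Rogawski1990, §4.5 p. 45] -/
theorem exists_wittParabolic_mul_mem_cmLocalIntegralLevel (e : WittIndex r m ≃ Fin N)
    (hstd : ∀ x, (e x).val = Sum.elim (fun i : Fin r => i.val) (Sum.elim (fun u : Fin m => r + u.val) (fun j : Fin r => r + m + j.val)) x)
    (S : Finset (Fin r)) (g : ↥(unitaryGroupOfForm (conjLocal L (IsCMField.complexConj L) v) (cmLocalForm L N v))) :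
    ∃ p : ↥(unitaryGroupOfForm (conjLocal L (IsCMField.complexConj L) v) (cmLocalForm L N v)),
      p ∈ wittParabolic (conjLocal L (IsCMField.complexConj L) v) (cmLocalForm L N v) e S ∧
      ∃ κ : ↥(unitaryGroupOfForm (conjLocal L (IsCMField.complexConj L) v) (cmLocalForm L N v)),
        κ ∈ cmLocalIntegralLevel L N (Matrix.of fun i j : Fin N => if i.val + j.val + 1 = N then (1 : L) else 0) v ∧ g = p * κ := by
  obtain ⟨h, κ, hκ, hg⟩ := exists_borel_mul_mem_cmLocalIntegralLevel L N v g
  have hb : (h : ↥(unitaryGroupOfForm (conjLocal L (IsCMField.complexConj L) v) (cmLocalForm L N v))) ∈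
      borelU (conjLocal L (IsCMField.complexConj L) v) (cmLocalForm L N v) := h.2
  exact ⟨h, borelU_le_wittParabolic_of_std (conjLocal L (IsCMField.complexConj L) v) (cmLocalForm L N v) e hstd S hb, κ, hκ, hg⟩

end CM

end Summit.HodgeConjecture.HodgeConjecture.Cruxes.H413.K2E3WittStandardIndexing

end
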